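import Summits.ValiantsHypothesis.ValiantsHypothesis.Theses.ShallowShadows
import Literature.Computability.Complexity.FormulaComposition

/-!
# Crux `RazWigdersonMatching` (stmt-ValiantsHypothesis-17127): the DNF upper bound and a refuted strengthening

Crux-disprover record (route `ShallowShadows`). The crux asks for `2^{c·m}` monotone formula gates
for the bipartite perfect matching function `PM_m` on `K_{m,m}` — an exponent LINEAR in the side
`m`, i.e. of order `√N` in the number `N = m²` of input variables. This file certifies, inside the
tree's straight-line model, the trivial upper bound that calibrates the statement:

* `size_bigAnd`, `size_bigOr` — gate counts of the iterated connectives of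
  `Literature.Computability.Complexity.FormulaComposition`;
* `formulaSizeOver_perfectMatchingFn_le` — the monotone DNF `⋁_{σ ∈ S_m} ⋀ᵢ x_{i,σ i}` has
  `m!·m − 1` gates, so `formulaSizeOver monotoneBasis (perfectMatchingFn m) ≤ m!·m` (`m ≥ 1`);
* `not_razWigdersonMatching_inputLength` — hence the NATURAL STRENGTHENING of the crux to an
  exponent linear in the input length, `2^{c·m²} ≤ formulaSizeOver …` eventually, is FALSE for
  every `c > 0` (at `m = 4^j`: `m!·m ≤ m^{m+1} = 2^{2j(m+1)} < 2^{c m²}`). The true order is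
  `2^{Θ(m)}` (Raz–Wigderson's lower bound; Hall's theorem gives `2^m·poly(m)` from above, not
  certified here), so a proof of the crux has a window of width exactly "linear in `m`" and no
  proof strategy may aim at `2^{Ω(N)}`.
-/

namespace Summit.ValiantsHypothesis.ValiantsHypothesis.Theorems.RazWigdersonMatching.Negative

-- summit = sub-problem name (single-conjunct summit, D-0017 layout), so the namespace repeats it
set_option linter.dupNamespace false

open Finset
open Literature.Computability.Complexity Literature.Computability.Complexity.Circuit
open Literature.Barriers.PneNP

/-- Gate count of the iterated conjunction: the gates of the parts plus `k` connectives.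
[folklore] -/
theorem size_bigAnd {ι : Type*} : ∀ (k : ℕ) (F : Fin (k + 1) → Circuit ι),
    (bigAnd k F).size = (∑ i, (F i).size) + k
  | 0, F => by simp [bigAnd]
  | k + 1, F => by
    rw [bigAnd, size_binop, size_bigAnd k, Fin.sum_univ_succ (n := k + 1)]
    omega

/-- Gate count of the iterated disjunction: the gates of the parts plus `k` connectives.
[folklore] -/
theorem size_bigOr {ι : Type*} : ∀ (k : ℕ) (F : Fin (k + 1) → Circuit ι),
    (bigOr k F).size = (∑ i, (F i).size) + k
  | 0, F => by simp [bigOr]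
  | k + 1, F => by
    rw [bigOr, size_binop, size_bigOr k, Fin.sum_univ_succ (n := k + 1)]
    omega

/-- **The DNF upper bound.** For `m ≥ 1` the monotone DNF of `PM_m` (one conjunction of `m`
variables per permutation) is a `{∧₂, ∨₂}`-formula with `m!·m − 1` gates, so
`formulaSizeOver monotoneBasis (perfectMatchingFn m) ≤ m!·m`. [folklore; Jukna 2012 §1.1] -/
theorem formulaSizeOver_perfectMatchingFn_le (m : ℕ) (hm : 1 ≤ m) :
    formulaSizeOver monotoneBasis (perfectMatchingFn m) ≤ m.factorial * m := by
  obtain ⟨k, rfl⟩ : ∃ k, m = k + 1 := ⟨m - 1, by omega⟩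
  obtain ⟨M, hM⟩ : ∃ M, Fintype.card (Equiv.Perm (Fin (k + 1))) = M + 1 :=
    ⟨Fintype.card (Equiv.Perm (Fin (k + 1))) - 1, by
      have := Fintype.card_pos (α := Equiv.Perm (Fin (k + 1)))
      omega⟩
  obtain ⟨e⟩ : Nonempty (Equiv.Perm (Fin (k + 1)) ≃ Fin (M + 1)) :=
    ⟨(Fintype.equivFin _).trans (finCongr hM)⟩
  have hM' : M + 1 = (k + 1).factorial := by rw [← hM, Fintype.card_perm, Fintype.card_fin]
  -- the DNF and its three structural properties (as in `exists_monotoneFormula_perfectMatchingFn`)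
  set F : Circuit (Fin (k + 1) × Fin (k + 1)) :=
    bigOr M fun j => bigAnd k fun i => input (i, e.symm j i) with hF
  have hover : F.IsOver monotoneBasis :=
    isOver_bigOr or_two_mem_monotoneBasis M _ fun j =>
      isOver_bigAnd and_two_mem_monotoneBasis k _ fun i => isOver_input _ _
  have hformula : F.IsFormula :=
    (isFormula_bigOr M _ fun j => isFormula_bigAnd k _ fun i => isFormula_input _).1
  have hcomp : F.Computes (perfectMatchingFn (k + 1)) := by
    intro x
    have hterm : ∀ σ : Equiv.Perm (Fin (k + 1)),
        (bigAnd k fun i => input (i, σ i)).eval x = true ↔ ∀ i, x (i, σ i) = true := by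
      intro σ
      simp only [eval_bigAnd, eval_input, decide_eq_true_eq]
    rw [hF, eval_bigOr]
    unfold perfectMatchingFn
    refine decide_eq_decide.mpr ⟨?_, ?_⟩
    · rintro ⟨j, hj⟩
      exact ⟨e.symm j, (hterm _).mp hj⟩
    · rintro ⟨σ, hσ⟩
      refine ⟨e σ, ?_⟩
      rw [Equiv.symm_apply_apply]
      exact (hterm σ).mpr hσ
  -- its size
  have hsize : F.size = (M + 1) * k + M := by
    rw [hF, size_bigOr]
    simp only [size_bigAnd, size_input, sum_const_zero, zero_add, sum_const, card_univ,
      Fintype.card_fin, smul_eq_mul]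
  calc formulaSizeOver monotoneBasis (perfectMatchingFn (k + 1))
      ≤ F.size := formulaSizeOver_le_of_computes F hover hformula hcomp
    _ = (M + 1) * k + M := hsize
    _ ≤ (k + 1).factorial * (k + 1) := by rw [← hM']; ring_nf; omega

/-- **Refuted strengthening: no exponent linear in the input length.** The crux
`RazWigdersonMatching` with `c·m` replaced by `c·m²` (`m²` = the number of variables of `PM_m`)
is false for EVERY `c > 0`: along `m = 4^j` the DNF bound `m!·m ≤ m^{m+1} = 2^{2j(m+1)}` beats
`2^{c m²}`. [folklore] -/
theorem not_razWigdersonMatching_inputLength :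
    ¬ ∃ c : ℝ, 0 < c ∧ ∃ m₀ : ℕ, ∀ m ≥ m₀,
      (2 : ℝ) ^ (c * (m : ℝ) ^ 2) ≤ formulaSizeOver monotoneBasis (perfectMatchingFn m) := by
  rintro ⟨c, hc, m₀, h⟩
  -- a large `j`: `j ≥ 1`, `j ≥ m₀`, `c·j > 4`; the side is `m = 2^(2j) = (2^j)²`
  obtain ⟨j, hj⟩ := exists_nat_gt (max (1 : ℝ) (max (m₀ : ℝ) (4 / c)))
  have hj1 : 1 ≤ j := by exact_mod_cast ((le_max_left _ _).trans hj.le)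
  have hjm : m₀ ≤ j := by
    exact_mod_cast ((le_max_left _ _).trans ((le_max_right _ _).trans hj.le))
  have hjc : 4 < c * j := by
    have : 4 / c < j := (le_max_right _ _).trans_lt ((le_max_right _ _).trans_lt hj)
    rwa [div_lt_iff₀ hc, mul_comm] at this
  set t : ℕ := 2 ^ j with ht
  set m : ℕ := 2 ^ (2 * j) with hm
  have htm : m = t * t := by rw [hm, ht, two_mul, pow_add]
  have hjt : j < t := Nat.lt_two_pow_self
  have htm' : t ≤ m := by rw [htm]; exact Nat.le_mul_of_pos_left t Nat.one_le_two_pow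
  have hm₀ : m₀ ≤ m := hjm.trans (hjt.le.trans htm')
  have hm1 : 1 ≤ m := Nat.one_le_two_pow
  -- the DNF bound, in `ℝ`
  have hup : (formulaSizeOver monotoneBasis (perfectMatchingFn m) : ℝ) ≤ (m : ℝ) ^ (m + 1) := by
    have h1 := formulaSizeOver_perfectMatchingFn_le m hm1
    have h2 : m.factorial * m ≤ m ^ (m + 1) := by
      rw [pow_succ]
      exact Nat.mul_le_mul_right _ (Nat.factorial_le_pow m)
    exact_mod_cast h1.trans h2
  have hpow : (m : ℝ) ^ (m + 1) = (2 : ℝ) ^ ((2 * j * (m + 1) : ℕ) : ℝ) := by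
    rw [Real.rpow_natCast, pow_mul, hm]
    push_cast
    ring
  -- the exponent comparison `2j (m + 1) < c m²`
  have hexp : ((2 * j * (m + 1) : ℕ) : ℝ) < c * (m : ℝ) ^ 2 := by
    have hjR : (1 : ℝ) ≤ j := by exact_mod_cast hj1
    have hjtR : (j : ℝ) < t := by exact_mod_cast hjt
    have hmR : (m : ℝ) = t * t := by exact_mod_cast htm
    have hct : 4 < c * t := hjc.trans (by nlinarith)
    have hcm : 4 * (j : ℝ) < c * m := by
      rw [hmR]
      nlinarith
    have hm1R : (1 : ℝ) ≤ m := by exact_mod_cast hm1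
    have hcm' : 4 * (j : ℝ) * m < c * m * m := by nlinarith
    push_cast
    nlinarith
  -- the contradiction `2^{c m²} ≤ size ≤ m^{m+1} = 2^{2j(m+1)} < 2^{c m²}`
  have hlt : (2 : ℝ) ^ ((2 * j * (m + 1) : ℕ) : ℝ) < (2 : ℝ) ^ (c * (m : ℝ) ^ 2) :=
    Real.rpow_lt_rpow_of_exponent_lt one_lt_two hexp
  have := h m hm₀
  linarith [hup, hpow ▸ hlt]

end Summit.ValiantsHypothesis.ValiantsHypothesis.Theorems.RazWigdersonMatching.Negative
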